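/-
Copyright (c) 2026 the pub-hodgecm-mathlib formalisation cell (harness21).  Prover seat hodgecm-mathlib-R90-IF-p01 (g0), programme R90-TF, section S9 «InnerForm-13.3.6 (c)»,
deal «G′-DATUM FIELDS (C5 posit-and-construct) for the DEFINITE INNER FORM» (R90-IF-plan, R90 bus 2026-09-04T16:20:19Z (2); RULING Q1 16:21:57Z: `Rep′` = unitary-equivalence CLASSES).
-/
import Summits.HodgeConjecture.HodgeConjecture.Theorems.R90S9SimilCongrLocalEquiv          -- ★ p861645 (this seat): `isSmoothVector_finRep_iff_of_equivariant` (smooth vectors correspond under an equivariant iso)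
import Summits.HodgeConjecture.HodgeConjecture.Theorems.R90S9SimilCongrLocalConstituents    -- ★ p861492 (R90-IF-p02): brings ★ `LocalConstituentsIn`, `CMLocalAPacket`, `IrrClass.isConstituentOf_congr` (one import for the S9 lane's currency)
import Summits.HodgeConjecture.HodgeConjecture.Theorems.F0P3aArchDefinitePlace              -- ★ `exists_definite_place` (anisotropic ⇒ a definite complex place)
import Literature.NumberTheory.Automorphic.CompactQuotientFiniteMultiplicity                -- ★ `multiplicity_lt_top_of_mem_discreteSpectrum_cmDatum` (finite multiplicities, anisotropic `H`)
import Literature.NumberTheory.Automorphic.LocalHermitianFormSign                           -- ★ `formSignAt` (the sign `c_v`)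
import HarnessLib

/-!
# R90-TF · S9 — the `G′`-datum of §14.5–§14.6 for the DEFINITE inner form `G′ = U(H)` (`H` anisotropic hermitian, `D = M₃(E)`, `S = ∅`): the fields of ★ `Ch14Sec6.GlobalData`
# that are constructible NOW, as concrete definitions (Rogawski 1990 §14.2 p. 232, §14.5 p. 237, §14.6 pp. 241–245; Deitmar–Echterhoff 2014 Thm. 9.2.2)

Cell `hodgecm-mathlib`, crux H413 = `stmt-HodgeConjecture-24833` (supports-only, count-neutral), route of record `HCCMUnconditional`; programme R90-TF (brief
`director/R90-BRIEF.v2.md` 1f40d54518340a35), section S9 = InnerForm-13.3.6 (c), seat R90-IF-p01 (g0); deal «G′-DATUM FIELDS» (R90-IF-plan 16:20:19Z (2)), names ADOPTED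
16:21:57Z, RULING Q1 «`Rep′` = unitary-equivalence CLASSES of discrete automorphic representations, `m′` their multiplicity in `L²_disc`, canonical `classOf`, and the
FACTORING LEMMAS that the constituent-reading predicates descend along `classOf`».  DEFINITIONS + LAWS (`--kind definition`, review lane); no instance, no notation, no
named-fact hypothesis, no `sorry`.  The `G`-side datum `𝔊` of ★ `Ch14Sec6.GlobalData` is READ BY NAME from S5-C (`R90.S5.PacketGOfRecord`, LEAD #22 J-D2-2 — no second
constructor here); the fields print OWES (global traces `tr′`, `θ_{G′} = traceL`, the correspondence `ψ′` at `S₀`, the archimedean halves of `Packet′ ∕ Π′(ξ)`, `MnNeZero`, and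
the `ρ`-side `LiftL2At ∕ Π′(ρ) ∕ sgn′ ∕ HasPinComponent`, not on (B4)'s path) are NOT defined here — consumers keep them as PARAMETERS (CENSUS-B4 §4, R90-IF-p04 (g0)).

## Contents (namespace `Summit.HodgeConjecture.HodgeConjecture.R90.S9.InnerFormSec146`; parameters `(L) (H : M₃(L))`, an automorphic `μA` FIXED — every automorphic measure
## is a positive multiple, (B0) ∕ (B4) quantify `∀ μ [IsAutomorphicMeasure μ]` and the cut instantiates at (B0)'s `μ`)
* §0 `areUnitarilyEquivalent_trans` (★ `AreUnitarilyEquivalent` is an equivalence relation: refl∕symm ★, trans here via Mathlib `ContRepresentation.Equiv.trans`);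
  **`isConstituentOf_iff_of_areUnitarilyEquivalent`** — THE FACTORING LEMMA: unitarily equivalent discrete `P, Q ⊂ L²(μA)` have the same `v`-constituents at every finite `v`
  (★ p861645 `isSmoothVector_finRep_iff_of_equivariant` at `Φ = 1`, `B = 1`: the equivalence restricts to the smooth local representations; ★ `IrrClass.isConstituentOf_congr`).
* §1 `Place := HeightOneSpectrum (𝓞 L⁺) ⊕ InfinitePlace L` [§14.2 p. 233] (the archimedean places are indexed by those of the CM field `L`, in bijection with those of `L⁺`),
  `S := ∅` [p. 233: `D = M₃(E)`], `S0 := {w ∣ ∞ : ±H^w ≻ 0}` [§14.2 p. 232: `G′_w ≅ U₃(ℝ)`], `DSplit := True` [§14.6 p. 243]; law `s0_nonempty` (anisotropic `H`, ★ `exists_definite_place`).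
* §2 `RepPrimeSetoid`, **`RepPrimeClass := Quotient`** (unitary-equivalence classes of ★ `DiscreteAutomorphicRep (adelicGroupData L⁺ L c̄ 3 H) μA`), `classOf`,
  `multiplicity_congr` (the multiplicity of a class is well defined), **`mPrime : RepPrimeClass → ℕ`** [§14.5 p. 237 `m(π′)`] with `mPrime_classOf`,
  `coe_mPrime_classOf` (`= multiplicity`, finite for anisotropic `H`: ★ `multiplicity_lt_top_of_mem_discreteSpectrum_cmDatum`), `one_le_multiplicity`, `mPrime_pos`, `mPrime_ne_zero`.
* §3 `PacketPrimeFin := ∀ v, CMLocalAPacket L H v` (the finite part of a global packet `Π′ = ⊗Π′_v` [§14.6 p. 242]; the finite part of `Π′(ξ)` IS ★ `xiPacketFamilyOfRecordSCD … ξ`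
  BY NAME — no alias), `memPrimeFin := LocalConstituentsIn` read on classes
  (`Quotient.lift` by §0), `memPrimeFin_classOf`; `IsPisAt` [Thm. 14.6.4 p. 244 «`π′_v = πˢ(ξ_v)`»] relative to a family of second members, on classes, `isPisAt_classOf`.
* §4 `cv` [§14.6 p. 243 `Δ′_v = c_v Δ″_v`]: `c_v = ε_v(H)` (★ `formSignAt`, the frame sign of the (d3) transport — `χ(a_v)` at non-split `v`, `1` at split `v`) at finite `v`, `1` at `∞`.
What is NOT here: `evpRep` (Q2 to R90-IF-p06 pending: E1 `evpAtIntegralLevel` currency vs the kit-free (AE) proxy of ★ p861479 — typed in edition 2 to his answer), `c = ∏ c_v`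
and its law `sec146_c` (needs the global product formula over the frames of ONE rational similitude — edition 2), and every OWED field above.
HONEST LABEL: bookkeeping definitions; proves no printed statement about automorphic forms; HC_CM is proved only modulo the 7 printed citations (2 remaining named inputs: hLiu418 =
`stmt-HodgeConjecture-24832`, h413 = `stmt-HodgeConjecture-24833`) until rung 0 closes.

## References
* [Rogawski1990] J. D. Rogawski, *Automorphic Representations of Unitary Groups in Three Variables*, Ann. of Math. Stud. 123 (1990), §14.2 pp. 232–233; §14.5 p. 237; §14.6
  pp. 241–245; §13.3 p. 201.
* [DeitmarEchterhoff2014] A. Deitmar, S. Echterhoff, *Principles of Harmonic Analysis*, 2nd ed. (2014), Thm. 9.2.2 (compact quotient: discrete decomposition, finite multiplicities).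
* [Dixmier1977] J. Dixmier, *C*-algebras* (1977), §5.4, §13.1.3 (unitary equivalence, multiplicity).
-/

set_option autoImplicit false
set_option linter.dupNamespace false  -- the mandated namespace repeats the summit's segment (`HodgeConjecture.HodgeConjecture`)

noncomputable section

open NumberField IsDedekindDomain MeasureTheory Topology
open scoped Matrix MatrixGroups ComplexOrder
open Literature.NumberTheory Literature.NumberTheory.Automorphic Literature.NumberTheory.Automorphic.UnitaryGroup
open Literature.NumberTheory.Rogawski1990 Literature.NumberTheory.GaloisRepresentations
open Summit.HodgeConjecture.HodgeConjecture.Cruxes.H413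

namespace Summit.HodgeConjecture.HodgeConjecture.R90.S9.InnerFormSec146

/-! ## §0 Unitary equivalence is transitive; unitarily equivalent discrete representations have the same local constituents -/

section Factoring

variable {L : Type} [Field L] [NumberField L] [IsCMField L] {H : Matrix (Fin 3) (Fin 3) L}
  {μA : Measure (adelicGroupData (↥(maximalRealSubfield L)) L (IsCMField.complexConj L) 3 H).automorphicQuotient}
  [(adelicGroupData (↥(maximalRealSubfield L)) L (IsCMField.complexConj L) 3 H).IsAutomorphicMeasure μA]

/-- Unitary equivalence of continuous representations is TRANSITIVE (composition of isometric equivalences; Mathlib `ContRepresentation.Equiv.trans`, `Isometry.comp`).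
[cite: Dixmier1977, §13.1.3] -/
theorem areUnitarilyEquivalent_trans {G V V' V'' : Type*} [Group G] [SeminormedAddCommGroup V] [Module ℂ V] [SeminormedAddCommGroup V'] [Module ℂ V']
    [SeminormedAddCommGroup V''] [Module ℂ V''] {π : ContRepresentation ℂ G V} {σ : ContRepresentation ℂ G V'} {τ : ContRepresentation ℂ G V''}
    (h : ContRepresentation.AreUnitarilyEquivalent π σ) (h' : ContRepresentation.AreUnitarilyEquivalent σ τ) : ContRepresentation.AreUnitarilyEquivalent π τ := by
  obtain ⟨e, he⟩ := h
  obtain ⟨e', he'⟩ := h'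
  exact ⟨e.trans e', fun x y => by rw [ContRepresentation.Equiv.trans_apply, ContRepresentation.Equiv.trans_apply, he' (e x) (e y), he x y]⟩

/-- **THE FACTORING LEMMA.**  Unitarily equivalent discrete automorphic representations `P, Q ⊂ L²(U(H)(L⁺)\U(H)(𝔸), μA)` have the SAME `v`-constituents at every finite place `v`
(constituents read in the smooth-part currency of ★ `MemXiFamily` ∕ `LocalConstituentsIn`): the equivalence `e : P ≃ Q` is `1`-equivariant, so smooth vectors correspond
(★ `isSmoothVector_finRep_iff_of_equivariant`, p861645, at `Φ = 1`, `B = 1`) and `e` restricts to an equivalence of the smooth local representations at `v` on the SAME group,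
read on classes by ★ `IrrClass.isConstituentOf_congr`.  Hence every predicate of the §14.6 datum that reads only local constituents descends to unitary-equivalence classes.
[cite: Rogawski1990, §14.2 p. 234; §13.3 p. 201] [cite: Dixmier1977, §13.1.3] -/
theorem isConstituentOf_iff_of_areUnitarilyEquivalent
    (P Q : DiscreteAutomorphicRep (adelicGroupData (↥(maximalRealSubfield L)) L (IsCMField.complexConj L) 3 H) μA)
    (h : ContRepresentation.AreUnitarilyEquivalent P.space.toContRep Q.space.toContRep)
    (v : HeightOneSpectrum (𝓞 ↥(maximalRealSubfield L))) (c : IrrClass ((cmDatum L 3 H).Local v)) :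
    (IrrClass.comap (localPiEquiv L (IsCMField.complexConj L) 3 H v) c).IsConstituentOf
        (P.finRep.smoothPart.toRepresentation.comp (inclPlace (↥(maximalRealSubfield L)) L (IsCMField.complexConj L) 3 H v)) ↔
      (IrrClass.comap (localPiEquiv L (IsCMField.complexConj L) 3 H v) c).IsConstituentOf
        (Q.finRep.smoothPart.toRepresentation.comp (inclPlace (↥(maximalRealSubfield L)) L (IsCMField.complexConj L) 3 H v)) := by
  obtain ⟨φ, -⟩ := h
  -- `e : P ≃ Q`, `1`-equivariant
  have he : ∀ (g : (adelicGroupData (↥(maximalRealSubfield L)) L (IsCMField.complexConj L) 3 H).Adelic) (w : P.space.toSubmodule),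
      φ.toContinuousLinearEquiv (P.space.toContRep g w) = Q.space.toContRep ((ContinuousMulEquiv.refl _) g) (φ.toContinuousLinearEquiv w) :=
    fun g w => congrArg (fun f : P.space.toSubmodule →L[ℂ] Q.space.toSubmodule => f w) (φ.isIntertwining g)
  -- the value law of `Φ = 1` against `B = 1`
  have hΦ : ∀ x : (adelicGroupData (↥(maximalRealSubfield L)) L (IsCMField.complexConj L) 3 H).Adelic,
      (Subtype.val ((ContinuousMulEquiv.refl _) x) : GL (Fin 3) (AdeleRing (𝓞 L) L)) =
        toAdeleGL L (1 : GL (Fin 3) L) * (Subtype.val x : GL (Fin 3) (AdeleRing (𝓞 L) L)) * (toAdeleGL L (1 : GL (Fin 3) L))⁻¹ := fun x => by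
    rw [map_one, one_mul, inv_one, mul_one]; rfl
  -- smooth vectors correspond (★ p861645), so `φ` restricts to an equivalence of the smooth local representations at `v` (same group: `Φ = 1`)
  have hsm := isSmoothVector_finRep_iff_of_equivariant (1 : GL (Fin 3) L) (ContinuousMulEquiv.refl _) hΦ P Q φ.toContinuousLinearEquiv he
  let E : P.finRep.smoothPart.toSubmodule ≃ₗ[ℂ] Q.finRep.smoothPart.toSubmodule :=
    { toFun := fun w => ⟨φ.toContinuousLinearEquiv (w : P.space.toSubmodule), (hsm _).1 w.2⟩
      map_add' := fun w w' => Subtype.ext (map_add φ.toContinuousLinearEquiv (w : P.space.toSubmodule) (w' : P.space.toSubmodule))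
      map_smul' := fun a w => Subtype.ext (map_smul φ.toContinuousLinearEquiv a (w : P.space.toSubmodule))
      invFun := fun w => ⟨φ.toContinuousLinearEquiv.symm (w : Q.space.toSubmodule),
        (hsm _).2 (by rw [ContinuousLinearEquiv.apply_symm_apply]; exact w.2)⟩
      left_inv := fun w => Subtype.ext (φ.toContinuousLinearEquiv.symm_apply_apply (w : P.space.toSubmodule))
      right_inv := fun w => Subtype.ext (φ.toContinuousLinearEquiv.apply_symm_apply (w : Q.space.toSubmodule)) }
  have φv : Representation.Equiv
      (P.finRep.smoothPart.toRepresentation.comp (inclPlace (↥(maximalRealSubfield L)) L (IsCMField.complexConj L) 3 H v))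
      (Q.finRep.smoothPart.toRepresentation.comp (inclPlace (↥(maximalRealSubfield L)) L (IsCMField.complexConj L) 3 H v)) :=
    Representation.Equiv.mk E fun x => LinearMap.ext fun w => Subtype.ext (he _ (w : P.space.toSubmodule))
  exact IrrClass.isConstituentOf_congr φv _

end Factoring

/-! ## §1 Places: `S = ∅`, `S₀` = the definite archimedean places, `D = M₃(E)` -/

section Places

variable (L : Type) [Field L] [NumberField L] [IsCMField L] (H : Matrix (Fin 3) (Fin 3) L)

/-- **The places** indexing the datum: finite places of `L⁺` and archimedean places of `L` (for the CM field `L` these are the complex places, in bijection with the real places of `L⁺`).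
[cite: Rogawski1990, §14.2 p. 233] -/
def Place : Type := HeightOneSpectrum (𝓞 ↥(maximalRealSubfield L)) ⊕ InfinitePlace L

/-- **`S = ∅`**: for `D = M₃(E)` the set `S` of finite places where `D` does not split is empty. [cite: Rogawski1990, §14.2 p. 233; §14.6 p. 243] -/
def S : Set (Place L) := ∅

/-- **`S₀`** = the archimedean places `w` with `G′_w ≅ U₃(ℝ)` compact, i.e. `H^w` or `-H^w` positive definite. [cite: Rogawski1990, §14.2 p. 232] -/
def S0 : Set (Place L) :=
  {p | ∃ w : InfinitePlace L, p = Sum.inr w ∧ ((H.map w.embedding).PosDef ∨ (-(H.map w.embedding)).PosDef)}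

/-- **`D = M₃(E)`** for the inner form `U(H)` of a hermitian MATRIX `H` on `E³`: holds by construction of ★ `adelicGroupData L⁺ L c̄ 3 H` (a predicate of `H`, vacuously
`True`; the division-algebra inner forms `D ≠ M₃(E)` of §14.2 are not of this shape). [cite: Rogawski1990, §14.6 p. 243; §14.2 p. 232] -/
def DSplit (_H : Matrix (Fin 3) (Fin 3) L) : Prop := True

omit [NumberField L] [IsCMField L] in
/-- `S = ∅` (unfolding). [cite: Rogawski1990, §14.2 p. 233] -/
theorem s_eq_empty : S L = ∅ := rfl

omit [Field L] [NumberField L] [IsCMField L] in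
/-- `D = M₃(E)` holds for `U(H)` (unfolding). [cite: Rogawski1990, §14.6 p. 243] -/
theorem dSplit : DSplit L H := trivial

/-- **`S₀ ≠ ∅` for an anisotropic hermitian `H`** (★ `exists_definite_place`: Landherr — an anisotropic hermitian form over a CM field is definite at some complex place).
[cite: Rogawski1990, §14.2 p. 232] [cite: Landherr1936HermitianForms] -/
theorem s0_nonempty (hherm : (H.map (cmConjRingHom L))ᵀ = H)
    (hanis : ∀ x : Fin 3 → L, Literature.AlgebraicGeometry.ShimuraVarieties.hermForm (cmConjRingHom L) H x x = 0 → x = 0) : (S0 L H).Nonempty := by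
  obtain ⟨w, hw⟩ := F0P3aArchDefinitePlace.exists_definite_place L H hherm hanis
  refine ⟨Sum.inr w.1, w.1, rfl, ?_⟩
  exact hw

end Places

/-! ## §2 `Rep′` = unitary-equivalence classes of discrete automorphic representations of `G′ = U(H)`, and `m(π′)` -/

section Classes

variable (L : Type) [Field L] [NumberField L] [IsCMField L] (H : Matrix (Fin 3) (Fin 3) L)
  (μA : Measure (adelicGroupData (↥(maximalRealSubfield L)) L (IsCMField.complexConj L) 3 H).automorphicQuotient)
  [(adelicGroupData (↥(maximalRealSubfield L)) L (IsCMField.complexConj L) 3 H).IsAutomorphicMeasure μA]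

/-- **Unitary equivalence** as a setoid on the discrete automorphic representations of `U(H)` in `L²(μA)`. [cite: Dixmier1977, §13.1.3] [cite: Rogawski1990, §14.5 p. 237] -/
def RepPrimeSetoid : Setoid (DiscreteAutomorphicRep (adelicGroupData (↥(maximalRealSubfield L)) L (IsCMField.complexConj L) 3 H) μA) where
  r P Q := ContRepresentation.AreUnitarilyEquivalent P.space.toContRep Q.space.toContRep
  iseqv := ⟨fun _ => ContRepresentation.AreUnitarilyEquivalent.refl _, fun h => h.symm, fun h h' => areUnitarilyEquivalent_trans h h'⟩

/-- **`Rep′`** — the irreducible unitary representations `π′` of `G′(𝔸) = U(H)(𝔸)` occurring in `L²_disc`, as UNITARY-EQUIVALENCE CLASSES of discrete automorphic representations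
(RULING Q1: `Σ' m(π′)·Tr π′(f′)` of §14.5 sums over classes). [cite: Rogawski1990, §14.5 p. 237; §14.6 p. 244] -/
def RepPrimeClass : Type := Quotient (RepPrimeSetoid L H μA)

/-- The class `[P]` of a discrete automorphic representation `P`. [cite: Rogawski1990, §14.5 p. 237] -/
def classOf (P : DiscreteAutomorphicRep (adelicGroupData (↥(maximalRealSubfield L)) L (IsCMField.complexConj L) 3 H) μA) : RepPrimeClass L H μA :=
  Quotient.mk (RepPrimeSetoid L H μA) P

/-- `classOf` is surjective. [cite: Rogawski1990, §14.5 p. 237] -/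
theorem classOf_surjective : Function.Surjective (classOf L H μA) :=
  Quotient.mk_surjective

/-- `[P] = [Q] ↔ P ≃ Q` unitarily. [cite: Dixmier1977, §13.1.3] -/
theorem classOf_eq_classOf_iff (P Q : DiscreteAutomorphicRep (adelicGroupData (↥(maximalRealSubfield L)) L (IsCMField.complexConj L) 3 H) μA) :
    classOf L H μA P = classOf L H μA Q ↔ ContRepresentation.AreUnitarilyEquivalent P.space.toContRep Q.space.toContRep :=
  Quotient.eq (r := RepPrimeSetoid L H μA)

/-- **The multiplicity of a class is well defined**: unitarily equivalent `P, Q` have the same multiplicity in `L²` (the families counted by ★ `ContRepresentation.multiplicity` for `P`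
and for `Q` coincide, by transitivity §0). [cite: Dixmier1977, §5.4] -/
theorem multiplicity_congr (P Q : DiscreteAutomorphicRep (adelicGroupData (↥(maximalRealSubfield L)) L (IsCMField.complexConj L) 3 H) μA)
    (h : ContRepresentation.AreUnitarilyEquivalent P.space.toContRep Q.space.toContRep) :
    ((adelicGroupData (↥(maximalRealSubfield L)) L (IsCMField.complexConj L) 3 H).rightRegular μA).multiplicity P.space.toContRep =
      ((adelicGroupData (↥(maximalRealSubfield L)) L (IsCMField.complexConj L) 3 H).rightRegular μA).multiplicity Q.space.toContRep := by
  unfold ContRepresentation.multiplicity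
  have hiff : ∀ W : ContRepresentation.ClosedSubrep ((adelicGroupData (↥(maximalRealSubfield L)) L (IsCMField.complexConj L) 3 H).rightRegular μA),
      ContRepresentation.AreUnitarilyEquivalent W.toContRep P.space.toContRep ↔ ContRepresentation.AreUnitarilyEquivalent W.toContRep Q.space.toContRep :=
    fun W => ⟨fun hW => areUnitarilyEquivalent_trans hW h, fun hW => areUnitarilyEquivalent_trans hW h.symm⟩
  simp only [hiff]

/-- **`m(π′)`** — the multiplicity of the class `π′` in the discrete spectrum `L²_disc(U(H)(L⁺)\U(H)(𝔸))` (★ `ContRepresentation.multiplicity`, descended by `multiplicity_congr`,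
read in `ℕ` by `ENat.toNat`; finite for anisotropic `H`, `coe_mPrime_classOf`). [cite: Rogawski1990, §14.5 p. 237] [cite: DeitmarEchterhoff2014, Thm. 9.2.2] -/
def mPrime : RepPrimeClass L H μA → ℕ :=
  Quotient.lift (fun P => (((adelicGroupData (↥(maximalRealSubfield L)) L (IsCMField.complexConj L) 3 H).rightRegular μA).multiplicity P.space.toContRep).toNat)
    fun P Q h => congrArg ENat.toNat (multiplicity_congr L H μA P Q h)

/-- `m([P]) = (multiplicity of P).toNat` (unfolding). [cite: Rogawski1990, §14.5 p. 237] -/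
theorem mPrime_classOf (P : DiscreteAutomorphicRep (adelicGroupData (↥(maximalRealSubfield L)) L (IsCMField.complexConj L) 3 H) μA) :
    mPrime L H μA (classOf L H μA P) = (((adelicGroupData (↥(maximalRealSubfield L)) L (IsCMField.complexConj L) 3 H).rightRegular μA).multiplicity P.space.toContRep).toNat :=
  rfl

/-- **For anisotropic `H`, `m([P])` IS the multiplicity** (finite: the automorphic quotient is compact, ★ `multiplicity_lt_top_of_mem_discreteSpectrum_cmDatum`).
[cite: DeitmarEchterhoff2014, Thm. 9.2.2] [cite: Rogawski1990, §14.5 p. 237] -/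
theorem coe_mPrime_classOf (hanis : ∀ x : Fin 3 → L, Literature.AlgebraicGeometry.ShimuraVarieties.hermForm (cmConjRingHom L) H x x = 0 → x = 0)
    (P : DiscreteAutomorphicRep (adelicGroupData (↥(maximalRealSubfield L)) L (IsCMField.complexConj L) 3 H) μA) :
    (mPrime L H μA (classOf L H μA P) : ℕ∞) = ((adelicGroupData (↥(maximalRealSubfield L)) L (IsCMField.complexConj L) 3 H).rightRegular μA).multiplicity P.space.toContRep := by
  rw [mPrime_classOf]
  -- `adelicGroupData L⁺ L c̄ 3 H = cmDatum L 3 H` (`rfl`, ★ `adelicGroupData_eq_cmDatum`): re-read the instance and the finiteness theorem on the `adelicGroupData` carriers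
  haveI : (cmDatum L 3 H).IsAutomorphicMeasure μA :=
    (inferInstance : (adelicGroupData (↥(maximalRealSubfield L)) L (IsCMField.complexConj L) 3 H).IsAutomorphicMeasure μA)
  have hfin : ((adelicGroupData (↥(maximalRealSubfield L)) L (IsCMField.complexConj L) 3 H).rightRegular μA).multiplicity P.space.toContRep < ⊤ :=
    multiplicity_lt_top_of_mem_discreteSpectrum_cmDatum L 3 H hanis μA P
  exact ENat.coe_toNat hfin.ne

/-- **A discrete automorphic representation occurs with multiplicity `≥ 1`**: the singleton family `{P}` is counted by ★ `ContRepresentation.multiplicity`. [cite: Dixmier1977, §5.4] -/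
theorem one_le_multiplicity (P : DiscreteAutomorphicRep (adelicGroupData (↥(maximalRealSubfield L)) L (IsCMField.complexConj L) 3 H) μA) :
    1 ≤ ((adelicGroupData (↥(maximalRealSubfield L)) L (IsCMField.complexConj L) 3 H).rightRegular μA).multiplicity P.space.toContRep := by
  unfold ContRepresentation.multiplicity
  refine le_iSup_of_le {P.space} (le_iSup_of_le (fun W hW => ?_) (le_iSup_of_le (by simp) (by simp)))
  rw [Finset.mem_singleton] at hW
  subst hW
  exact ⟨P.irreducible, ContRepresentation.AreUnitarilyEquivalent.refl _⟩

/-- **`m(π′) ≥ 1` for anisotropic `H`**: every class of `Rep′` occurs in `L²_disc` (by `one_le_multiplicity` and finiteness, `coe_mPrime_classOf`). [cite: Rogawski1990, §14.5 p. 237]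
[cite: Dixmier1977, §5.4] -/
theorem mPrime_pos (hanis : ∀ x : Fin 3 → L, Literature.AlgebraicGeometry.ShimuraVarieties.hermForm (cmConjRingHom L) H x x = 0 → x = 0)
    (P : DiscreteAutomorphicRep (adelicGroupData (↥(maximalRealSubfield L)) L (IsCMField.complexConj L) 3 H) μA) : 0 < mPrime L H μA (classOf L H μA P) := by
  have h1 := one_le_multiplicity L H μA P
  rw [← coe_mPrime_classOf L H μA hanis P, ← ENat.coe_one, ENat.coe_le_coe] at h1
  exact h1

/-- `m(π′) ≠ 0` for anisotropic `H` — the shape of the pin `hm : Γ.m' π′ ≠ 0` of the (AE-ⅱ) junction cut (R90-IF-p06) at `π′ := classOf P`. [cite: Rogawski1990, §14.5 p. 237] -/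
theorem mPrime_ne_zero (hanis : ∀ x : Fin 3 → L, Literature.AlgebraicGeometry.ShimuraVarieties.hermForm (cmConjRingHom L) H x x = 0 → x = 0)
    (P : DiscreteAutomorphicRep (adelicGroupData (↥(maximalRealSubfield L)) L (IsCMField.complexConj L) 3 H) μA) : mPrime L H μA (classOf L H μA P) ≠ 0 :=
  (mPrime_pos L H μA hanis P).ne'

end Classes

/-! ## §3 The finite part of a global packet of `G′`; membership and `IsPisAt` read on classes -/

section Packets

variable (L : Type) [Field L] [NumberField L] [IsCMField L] (H : Matrix (Fin 3) (Fin 3) L)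
  (μA : Measure (adelicGroupData (↥(maximalRealSubfield L)) L (IsCMField.complexConj L) 3 H).automorphicQuotient)
  [(adelicGroupData (↥(maximalRealSubfield L)) L (IsCMField.complexConj L) 3 H).IsAutomorphicMeasure μA]

/-- **The finite part `⊗_{v < ∞} Π′_v` of a global packet of `G′`**: a family of CM-local A-packets (★ `CMLocalAPacket`). [cite: Rogawski1990, §14.6 p. 242; §13.1 p. 199] -/
abbrev PacketPrimeFin : Type 1 := ∀ v : HeightOneSpectrum (𝓞 ↥(maximalRealSubfield L)), CMLocalAPacket L H v

/-- **`π′ ∈ Π′` (finite part), on classes**: every finite local constituent of (any representative of) `π′` lies in `Π′_v` — ★ `LocalConstituentsIn`, descended by §0.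
[cite: Rogawski1990, §14.6 p. 242; §13.3 p. 201] -/
def memPrimeFin (π' : RepPrimeClass L H μA) (Pk : PacketPrimeFin L H) : Prop :=
  Quotient.liftOn π' (fun P => LocalConstituentsIn P Pk) fun P Q h => by
    refine propext ⟨fun hP v c hc => hP v c ?_, fun hQ v c hc => hQ v c ?_⟩
    · exact (isConstituentOf_iff_of_areUnitarilyEquivalent P Q h v c).2 hc
    · exact (isConstituentOf_iff_of_areUnitarilyEquivalent P Q h v c).1 hc

/-- `memPrimeFin [P] Pk ↔ LocalConstituentsIn P Pk` (unfolding). [cite: Rogawski1990, §14.6 p. 242] -/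
theorem memPrimeFin_classOf (P : DiscreteAutomorphicRep (adelicGroupData (↥(maximalRealSubfield L)) L (IsCMField.complexConj L) 3 H) μA) (Pk : PacketPrimeFin L H) :
    memPrimeFin L H μA (classOf L H μA P) Pk ↔ LocalConstituentsIn P Pk :=
  Iff.rfl

/-- **«`π′_v = πˢ(ξ_v)`»** [Thm. 14.6.4] relative to a family `πs` of second members (`none` at split `v`; e.g. `fun v => (Π′(ξ)_v).πs` of the record family), on classes: at `v`, a second
member is named and EVERY `v`-constituent of `π′` is it. [cite: Rogawski1990, Thm. 14.6.4 p. 244] -/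
def IsPisAt (π' : RepPrimeClass L H μA) (πs : ∀ v : HeightOneSpectrum (𝓞 ↥(maximalRealSubfield L)), Option (IrrClass ((cmDatum L 3 H).Local v)))
    (v : HeightOneSpectrum (𝓞 ↥(maximalRealSubfield L))) : Prop :=
  Quotient.liftOn π' (fun P => ∃ s, πs v = some s ∧ ∀ c : IrrClass ((cmDatum L 3 H).Local v),
      (IrrClass.comap (localPiEquiv L (IsCMField.complexConj L) 3 H v) c).IsConstituentOf
        (P.finRep.smoothPart.toRepresentation.comp (inclPlace (↥(maximalRealSubfield L)) L (IsCMField.complexConj L) 3 H v)) → c = s)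
    fun P Q h => by
      refine propext (exists_congr fun s => and_congr_right fun _ => forall_congr' fun c => ?_)
      rw [isConstituentOf_iff_of_areUnitarilyEquivalent P Q h v c]

/-- `IsPisAt [P] πs v` unfolded on a representative. [cite: Rogawski1990, Thm. 14.6.4 p. 244] -/
theorem isPisAt_classOf (P : DiscreteAutomorphicRep (adelicGroupData (↥(maximalRealSubfield L)) L (IsCMField.complexConj L) 3 H) μA)
    (πs : ∀ v : HeightOneSpectrum (𝓞 ↥(maximalRealSubfield L)), Option (IrrClass ((cmDatum L 3 H).Local v))) (v : HeightOneSpectrum (𝓞 ↥(maximalRealSubfield L))) :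
    IsPisAt L H μA (classOf L H μA P) πs v ↔ ∃ s, πs v = some s ∧ ∀ c : IrrClass ((cmDatum L 3 H).Local v),
      (IrrClass.comap (localPiEquiv L (IsCMField.complexConj L) 3 H v) c).IsConstituentOf
        (P.finRep.smoothPart.toRepresentation.comp (inclPlace (↥(maximalRealSubfield L)) L (IsCMField.complexConj L) 3 H v)) → c = s :=
  Iff.rfl

end Packets

/-! ## §4 The local constants `c_v` -/

section Constants

variable (L : Type) [Field L] [NumberField L] [IsCMField L] (H : Matrix (Fin 3) (Fin 3) L)

/-- **`c_v`** with `Δ′_v = c_v · Δ″_v` [§14.6 p. 243], for the tree's factors of record `Δ‴_H` (G′-side) and `Δ‴_{Φ₃}` transported along a frame: at a finite `v` the frame sign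
`ε_v(H) = ★ formSignAt` (`χ(a_v) = ±1` at non-split `v`, the (d3) transport ★ p861691; `1` at split `v`, ★ `formSignAt_of_not_subsingleton`), at `∞` the constant `1`.
[cite: Rogawski1990, §14.6 p. 243; §4.3 (4.3.2) p. 43] -/
def cv : Place L → ℂ
  | Sum.inl v => ((formSignAt L (IsCMField.complexConj L) H v : ℤ) : ℂ)
  | Sum.inr _ => 1

/-- `c_w = 1` at an archimedean place (unfolding). [cite: Rogawski1990, §14.6 p. 243] -/
theorem cv_inr (w : InfinitePlace L) : cv L H (Sum.inr w) = 1 := rfl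

/-- `c_v = ε_v(H)` at a finite place (unfolding). [cite: Rogawski1990, §14.6 p. 243] -/
theorem cv_inl (v : HeightOneSpectrum (𝓞 ↥(maximalRealSubfield L))) : cv L H (Sum.inl v) = ((formSignAt L (IsCMField.complexConj L) H v : ℤ) : ℂ) := rfl

end Constants

end Summit.HodgeConjecture.HodgeConjecture.R90.S9.InnerFormSec146

end
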